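import Mathlib.MeasureTheory.Measure.Prokhorov
import Mathlib.Topology.Sets.VietorisTopology
import Literature.Probability.Percolation.OneArmHittingPDEProofs
import HarnessLib

/-!
# The one-arm exponent from subsequential scaling limits (LSW 2002, §2 read along subsequences)

Topic `Literature/Probability/Percolation`; family `crit-perc`. This file continues the
bottom-up discharge of the named fact `Literature.Probability.Percolation.oneArm_exponent`
(`ArmExponents.lean`; Lawler–Schramm–Werner, *One-arm exponent for critical 2D percolation*,
Electron. J. Probab. **7** (2002), paper no. 2, Thm. 1.1).

State of the reduction before this file (`OneArmLSW.lean`, `TriAnnulusCircuit.lean`,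
`OneArmScalingLimit.lean`, `OneArmMaximumPrinciple.lean`, `OneArmHittingPDE.lean`,
`OneArmHittingPDEProofs.lean`): `oneArm_exponent` follows from exactly two continuum inputs,

* the existence of the scaling limit — the laws `lswLaw R` of LSW's sets `Q_{1/R}` converge
  weakly as `R → ∞` (LSW §2, p. 3: "By [22, 23], the limit exists"; Smirnov 2001, Camia–Newman
  2006; then the named fact `LawlerSchrammWerner2002_scalingLimit`, since 2026-08-15 the explicit
  hypothesis `∃ ν, Tendsto lswLaw atTop (𝓝 ν)`), and
* `LawlerSchrammWerner2002_hittingPDE` — for the weak limit `ν`, the hitting function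
  `h(θ, t) = P[𝔯(θ) ≤ e^{-t}]` of (2.2) exists with Lemma 2.2 (PDE (2.4), `κ = 6`), (2.3) and
  Lemma 2.3, and `h(2π, t) = ν{𝔯 ≤ e^{-t}}`,

everything else in LSW's proof (RSW, §3, (3.1), Thm. 1.2 from the lemmas via the maximum
principle (2.17), Koebe, (2.1)) being proved (`oneArm_exponent_of_scalingLimit_of_hittingPDE`).

Here the first input is removed from the trust base. The sets `Q_δ` all lie in the closed unit
disc, so their laws live on ONE compact subset `{K | K ⊆ Ū}` of the Hausdorff space
(`TopologicalSpace.NonemptyCompacts.isCompact_subsets_of_isCompact`); hence `{lswLaw R}` is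
tight for free and, by Prokhorov's theorem (Mathlib's `isCompact_closure_of_isTightMeasureSet`)
and the metrisability of weak convergence (Lévy–Prokhorov), every sequence `R_k → ∞` has a
subsequence along which `lswLaw` converges weakly (`exists_tendsto_lswLaw_subseq`, PROVED). LSW's
§3 deduction of Thm. 1.1 only ever uses the bounds of Thm. 1.2 at such subsequential limits,
provided the constant of Thm. 1.2 is the same for all of them — and it is, as soon as all
subsequential limits share the hitting function `h(2π, ·)` of (2.2): the constant produced by
the maximum principle depends on `h` alone (`IsHittingPDEData.measure_bounds`,
`OneArmHittingPDE.lean`). This gives: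

* the *subsequential hitting-PDE hypotheses* (explicit hypotheses of the theorems below, not a
  named fact): ONE datum `(h, h_θ, h_θθ, h_t)` with the properties of LSW Lemma 2.2, (2.3),
  Lemma 2.3 (`H : IsHittingPDEData h h_θ h_θθ h_t`) such that
  `h(2π, t) = ν{K | 𝔯(K) ≤ e^{-t}}` for EVERY subsequential weak limit `ν` of `lswLaw` along a
  sequence `R_k → ∞` (`hid`). In the paper the limit exists, so its subsequential limits all
  coincide with `Q = Q(2π)` and this is (2.2) + Lemma 2.2 + (2.3) + Lemma 2.3 verbatim;
  `LawlerSchrammWerner2002_subseqHittingPDE_of_scalingLimit` PROVES that such a datum exists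
  under the two old facts (uniqueness of weak limits, the space of Borel probability measures
  being Hausdorff), so the hypotheses are weaker than what is printed. Their content is
  Smirnov's theorem as LSW use it (Thm. 2.1, the `SLE₆` description of the scaling limit
  `Q(θ)`, which identifies every subsequential limit) together with LSW §2 (Lemmas 2.2–2.3,
  the radial-`SLE₆` law of the conformal radius) — the proof obligation of
  `LawlerSchrammWerner2002_hittingPDE` itself. (They were briefly bundled as a named fact
  `LawlerSchrammWerner2002_subseqHittingPDE`, p15040; being that conjunction read at
  subsequential limits rather than a distinct printed result, the bundle was merged back into
  the hypotheses on the D-0026 review of the decomposition, 2026-08-15; theorem names kept.)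
* `crossingBounds_of_subseqLimits` (THEOREM): uniform two-sided power bounds at all
  subsequential limits give LSW's (3.1)-type bounds `c r^{5/48} ≤ P[C(rR, R)] ≤ c' r^{5/48}` for
  all large `R` (contradiction + portmanteau along the extracted subsequence).
* `oneArm_exponent_of_subseqHittingPDE` (THEOREM): the subsequential hitting-PDE hypotheses
  `H`, `hid` imply `oneArm_exponent`.

After this file the one-arm exponent is reduced to the subsequential hitting-PDE hypotheses;
through `LawlerSchrammWerner2002_subseqHittingPDE_of_scalingLimit` it rests on the existence of
the weak limit of `lswLaw` together with the named fact `LawlerSchrammWerner2002_hittingPDE`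
(as in `oneArm_exponent_of_scalingLimit_of_hittingPDE`, `OneArmHittingPDEProofs.lean`), the
existence of the full limit being needed only to know that all subsequential limits share
`h(2π, ·)`.

## References

* G. F. Lawler, O. Schramm, W. Werner, *One-arm exponent for critical 2D percolation*, Electron.
  J. Probab. 7 (2002), no. 2 — Thm. 1.1, Thm. 1.2 (p. 2), §2 (pp. 3–8), §3 (pp. 8–9)
  [LawlerSchrammWernerEJP2002].
* S. Smirnov, *Critical percolation in the plane: conformal invariance, Cardy's formula, scaling
  limits*, C. R. Acad. Sci. Paris 333 (2001) 239–244 [Smirnov2001].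
* P. Billingsley, *Convergence of probability measures*, 2nd ed. (1999), Thms. 2.1, 5.1
  [Billingsley1999].
-/

noncomputable section

open MeasureTheory Filter Topology Metric Set TopologicalSpace
open Literature.Probability.LatticeModels Literature.Probability.Percolation
open scoped ENNReal NNReal

namespace Literature.Probability.Percolation

/-! ### All `Q_δ` lie in the closed unit disc: tightness for free -/

/-- The compact subset of the Hausdorff space carrying all the laws `lswLaw R`: the nonempty
compact subsets of the closed unit disc `Ū` (LSW 2002, §2, p. 3: "a probability measure on the
Hausdorff space of compact subsets of `Ū`"). [cite: LawlerSchrammWernerEJP2002, §2 (p. 3)] -/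
def subUnitDisc : Set (NonemptyCompacts ℂ) :=
  {K | (K : Set ℂ) ⊆ closedBall (0 : ℂ) 1}

/-- Membership in `subUnitDisc`, unfolded. [folklore] -/
@[simp] theorem mem_subUnitDisc_iff {K : NonemptyCompacts ℂ} :
    K ∈ subUnitDisc ↔ (K : Set ℂ) ⊆ closedBall (0 : ℂ) 1 := Iff.rfl

/-- The nonempty compact subsets of a compact set form a compact subset of the Hausdorff space
(Mathlib, Vietoris topology = Hausdorff-metric topology on `NonemptyCompacts`). [folklore] -/
theorem isCompact_subUnitDisc : IsCompact subUnitDisc :=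
  NonemptyCompacts.isCompact_subsets_of_isCompact (isCompact_closedBall (0 : ℂ) 1)

/-- `subUnitDisc` is closed (a compact subset of a Hausdorff space). [folklore] -/
theorem isClosed_subUnitDisc : IsClosed subUnitDisc :=
  isCompact_subUnitDisc.isClosed

/-- `Q_δ ⊆ Ū`: the circle `∂𝕌` and the rescaled sites `R⁻¹ x`, `‖x‖ < R`.
[cite: LawlerSchrammWernerEJP2002, §2 (p. 3)] -/
theorem lswSet_subset_closedBall (R : ℝ) (ω : SiteConfig (Site 2)) :
    lswSet R ω ⊆ closedBall (0 : ℂ) 1 := by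
  rintro p (hp | ⟨x, hx, rfl⟩)
  · exact sphere_subset_closedBall hp
  · rw [mem_closedBall, dist_zero_right]
    have hxR : ‖triEmbed x‖ < R := hx.1
    have hR : 0 < R := lt_of_le_of_lt (norm_nonneg _) hxR
    rw [norm_triMeshPoint_inv hR, div_le_one hR]
    exact hxR.le

/-- `Q_δ ∈ subUnitDisc` for every mesh and configuration. [folklore] -/
theorem lswCompact_mem_subUnitDisc (R : ℝ) (ω : SiteConfig (Site 2)) :
    lswCompact R ω ∈ subUnitDisc :=
  lswSet_subset_closedBall R ω

/-- The laws `lswLaw R` give full mass to `subUnitDisc`. [folklore] -/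
theorem lswLaw_compl_subUnitDisc (R : ℝ) :
    (lswLaw R : Measure (NonemptyCompacts ℂ)) subUnitDiscᶜ = 0 := by
  rw [lswLaw_apply R isClosed_subUnitDisc.measurableSet.compl]
  have : lswCompact R ⁻¹' subUnitDiscᶜ = ∅ :=
    eq_empty_of_forall_notMem fun ω hω => hω (lswCompact_mem_subUnitDisc R ω)
  rw [this, measure_empty]

/-- **Tightness of the laws of `Q_δ`** (trivially: one compact set carries them all).
[folklore] -/
theorem isTightMeasureSet_lswLaw :
    IsTightMeasureSet {μ : Measure (NonemptyCompacts ℂ) | ∃ R : ℝ, (lswLaw R : Measure _) = μ} := by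
  rw [isTightMeasureSet_iff_exists_isCompact_measure_compl_le]
  intro ε _
  refine ⟨subUnitDisc, isCompact_subUnitDisc, ?_⟩
  rintro μ ⟨R, rfl⟩
  rw [lswLaw_compl_subUnitDisc R]
  exact zero_le

/-- **Relative compactness of the laws of `Q_δ`** (Prokhorov's theorem, Mathlib's
`isCompact_closure_of_isTightMeasureSet`; Billingsley 1999, Thm. 5.1).
[cite: Billingsley1999, Thm 5.1] -/
theorem isCompact_closure_range_lswLaw : IsCompact (closure (range lswLaw)) := by
  apply isCompact_closure_of_isTightMeasureSet
  refine isTightMeasureSet_lswLaw.subset ?_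
  rintro _ ⟨μ, ⟨R, rfl⟩, rfl⟩
  exact ⟨R, rfl⟩

/-- **Subsequential scaling limits exist**: every sequence of meshes has a subsequence along
which the laws of `Q_δ` converge weakly (compactness + metrisability of weak convergence on a
separable metric space). [cite: Billingsley1999, Thm 5.1] -/
theorem exists_tendsto_lswLaw_subseq (R : ℕ → ℝ) :
    ∃ ν : ProbabilityMeasure (NonemptyCompacts ℂ), ∃ φ : ℕ → ℕ, StrictMono φ ∧
      Tendsto (lswLaw ∘ R ∘ φ) atTop (𝓝 ν) := by
  obtain ⟨ν, -, φ, hφ, hconv⟩ := isCompact_closure_range_lswLaw.tendsto_subseq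
    (x := lswLaw ∘ R) fun n => subset_closure ⟨R n, rfl⟩
  exact ⟨ν, φ, hφ, hconv⟩

/-! ### The subsequential hitting-PDE hypotheses: LSW §2 at subsequential limits -/

/-- **Lawler–Schramm–Werner 2002, §2 ((2.2), Lemma 2.2, (2.3), Lemma 2.3), read at subsequential
scaling limits, follows from the printed pair of facts.** The *subsequential hitting-PDE
hypotheses* used below are: one datum `(h, h_θ, h_θθ, h_t)` — in the paper
`h(θ, t) = P[𝔯(θ) ≤ e^{-t}]` (2.2), `𝔯(θ)` the conformal radius about `0` of the component of `0`
in `𝕌 ∖ Q(θ)`, `Q(θ)` the scaling limit of the union of the arc `A_θ` with the clusters meeting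
it, and its partial derivatives — with: `h(θ, ·)` non-increasing, `[0, 1]`-valued, positive on
`(0, 2π]`; **Lemma 2.2** (p. 4): on `(0, 2π) × (0, ∞)` the derivatives exist, are continuous, and
the PDE (2.4) holds with `κ = 6`; **(2.3)** (p. 4): `h(0, t) = lim_{θ↓0} h(θ, t) = 0` for `t > 0`;
**Lemma 2.3** (p. 6, (2.12)): the one-sided `θ`-derivative at `2π` of `h̃ = ∫₀¹ h(·, t + s) ds`
vanishes (all bundled as `IsHittingPDEData`, `OneArmHittingPDE.lean`); and such that
**(2.2) at `θ = 2π`** holds for every subsequential weak limit `ν` of the laws `lswLaw R` of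
`Q_{1/R}` along a sequence `R_k → ∞`: `h(2π, t) = ν{K | 𝔯(K) ≤ e^{-t}}` for all `t`. In the paper
the weak limit exists (§2, p. 3: "By [22, 23], the limit exists, and, moreover, it can be
explicitly described via SLE₆", Thm. 2.1 (Smirnov)), so all subsequential limits equal
`Q = Q(2π)` and this is the printed (2.2) + Lemma 2.2 + (2.3) + Lemma 2.3. Accordingly, if the
weak limit of `lswLaw` exists (hypothesis `h₁`) and LSW §2 holds for it
(`LawlerSchrammWerner2002_hittingPDE`), such a datum exists — every subsequential limit is the
limit, weak limits of Borel probability measures on a metric space being unique. The printed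
proofs rest on Smirnov's theorem, the chordal/radial equivalence of `SLE₆` [13, Thm. 4.1], the
radial Loewner equation (2.5)–(2.6), Itô's formula (2.10)–(2.11), and the half-plane three-arm
estimate (2.13) (Appendix A). (Formerly the conclusion was the named fact
`LawlerSchrammWerner2002_subseqHittingPDE`; merged back into explicit hypotheses 2026-08-15,
see the module docstring; the theorem keeps its name.)
[cite: LawlerSchrammWernerEJP2002, §2: (2.2)–(2.4), Lemma 2.2 (p. 4), (2.3) (p. 4), Lemma 2.3 (p. 6), Thm. 2.1 (p. 3)] -/
theorem LawlerSchrammWerner2002_subseqHittingPDE_of_scalingLimit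
    (h₁ : ∃ ν : ProbabilityMeasure (NonemptyCompacts ℂ), Tendsto lswLaw atTop (𝓝 ν))
    (h₂ : LawlerSchrammWerner2002_hittingPDE) :
    ∃ h hθ hθθ ht : ℝ → ℝ → ℝ, IsHittingPDEData h hθ hθθ ht ∧
      ∀ (R : ℕ → ℝ) (ν : ProbabilityMeasure (NonemptyCompacts ℂ)),
        Tendsto R atTop atTop → Tendsto (lswLaw ∘ R) atTop (𝓝 ν) →
          ∀ t, h (2 * Real.pi) t = (ν : Measure (NonemptyCompacts ℂ)).real
            {K | Literature.Analysis.Complex.conformalRadius (K : Set ℂ) ≤ Real.exp (-t)} := by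
  obtain ⟨ν₀, hν₀⟩ := h₁
  obtain ⟨h, hθ, hθθ, ht, h2π, hanti, hIcc, hpos, hder, hcθ, hcθθ, hct, hpde, hdir, hneu⟩ :=
    h₂ ν₀ hν₀
  refine ⟨h, hθ, hθθ, ht, ⟨hanti, hIcc, hpos, hder, hcθ, hcθθ, hct, hpde, hdir, hneu⟩,
    fun R ν hR hν t => ?_⟩
  have hν' : Tendsto (lswLaw ∘ R) atTop (𝓝 ν₀) := hν₀.comp hR
  rw [tendsto_nhds_unique hν hν']
  exact h2π t

/-! ### From uniform bounds at subsequential limits to LSW's (3.1)-type bounds -/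

/-- `P_{1/2}[C(rR, R)] = lswLaw R (meetsBall r)` in `ℝ≥0∞`, for `0 < r ≤ 1`, `R > 0`.
[cite: LawlerSchrammWernerEJP2002, §3 (p. 8)] -/
theorem lswLaw_meetsBall_eq {r R : ℝ} (hr : r ≤ 1) (hR : 0 < R) :
    (lswLaw R : Measure (NonemptyCompacts ℂ)) (meetsBall r) =
      ENNReal.ofReal ((triSitePercolation half).real (triOpenCrossing (r * R) R)) := by
  rw [real_triOpenCrossing_eq hr hR, ENNReal.ofReal_toReal (measure_ne_top _ _)]

/-- **Lower (3.1)-type bound from subsequential limits.** If every subsequential weak limit `ν`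
of `lswLaw` along sequences `R_k → ∞` satisfies `ℓ ≤ ν{dist(0, K) < r}`, then for every `L < ℓ`,
`L ≤ P[C(rR, R)]` for all large `R` (`0 < r ≤ 1`). Proof: otherwise pick `R_k ≥ k` violating the
bound, extract a convergent subsequence (`exists_tendsto_lswLaw_subseq`), and contradict the
portmanteau inequality `ν(G) ≤ liminf P_k(G)` for the open set `G = meetsBall r`.
[cite: LawlerSchrammWernerEJP2002, §3 (3.1) (p. 8)] [cite: Billingsley1999, Thm 2.1] -/
theorem eventually_le_crossing_of_subseqLimits {r ℓ L : ℝ} (hr1 : r ≤ 1) (hL : L < ℓ)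
    (hlim : ∀ (R : ℕ → ℝ) (ν : ProbabilityMeasure (NonemptyCompacts ℂ)),
      Tendsto R atTop atTop → Tendsto (lswLaw ∘ R) atTop (𝓝 ν) →
        ℓ ≤ (ν : Measure (NonemptyCompacts ℂ)).real (meetsBall r)) :
    ∃ s₀ : ℝ, ∀ R : ℝ, s₀ ≤ R →
      L ≤ (triSitePercolation half).real (triOpenCrossing (r * R) R) := by
  by_contra hcon
  push Not at hcon
  -- a sequence `R_k ≥ k + 1` of violations
  choose R hRge hRlt using fun k : ℕ => hcon ((k : ℝ) + 1)
  have hRpos : ∀ k, 0 < R k := fun k => lt_of_lt_of_le (Nat.cast_add_one_pos k) (hRge k)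
  have hRtop : Tendsto R atTop atTop := by
    refine tendsto_atTop_mono (fun k => (hRge k)) ?_
    exact tendsto_natCast_atTop_atTop.atTop_add tendsto_const_nhds
  obtain ⟨ν, φ, hφ, hconv⟩ := exists_tendsto_lswLaw_subseq R
  have hℓ := hlim (R ∘ φ) ν (hRtop.comp hφ.tendsto_atTop) hconv
  -- portmanteau along the subsequence
  have hport : (ν : Measure (NonemptyCompacts ℂ)) (meetsBall r) ≤
      liminf (fun k => ((lswLaw ∘ R ∘ φ) k : Measure (NonemptyCompacts ℂ)) (meetsBall r)) atTop :=
    ProbabilityMeasure.le_liminf_measure_open_of_tendsto hconv (isOpen_meetsBall r)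
  have hle : liminf (fun k => ((lswLaw ∘ R ∘ φ) k : Measure (NonemptyCompacts ℂ)) (meetsBall r))
      atTop ≤ ENNReal.ofReal L := by
    refine liminf_le_of_frequently_le (Eventually.of_forall fun k => ?_).frequently
    simp only [Function.comp_apply]
    rw [lswLaw_meetsBall_eq hr1 (hRpos (φ k))]
    exact ENNReal.ofReal_le_ofReal (hRlt (φ k)).le
  have hL0 : 0 ≤ L := by
    by_contra hL0
    push Not at hL0
    have := hRlt (φ 0)
    linarith [measureReal_nonneg (μ := triSitePercolation half)
      (s := triOpenCrossing (r * R (φ 0)) (R (φ 0)))]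
  have : (ν : Measure (NonemptyCompacts ℂ)).real (meetsBall r) ≤ L := by
    rw [measureReal_def, ← ENNReal.toReal_ofReal hL0]
    exact ENNReal.toReal_mono ENNReal.ofReal_ne_top (hport.trans hle)
  linarith

/-- **Upper (3.1)-type bound from subsequential limits.** If every subsequential weak limit `ν`
of `lswLaw` along sequences `R_k → ∞` satisfies `ν{dist(0, K) ≤ r} ≤ u`, then for every `U > u`,
`P[C(rR, R)] ≤ U` for all large `R` (`0 < r ≤ 1`): portmanteau `limsup P_k(F) ≤ ν(F)` for the
closed set `F = meetsClosedBall r ⊇ meetsBall r`.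
[cite: LawlerSchrammWernerEJP2002, §3 (3.1) (p. 8)] [cite: Billingsley1999, Thm 2.1] -/
theorem eventually_crossing_le_of_subseqLimits {r u U : ℝ} (hr1 : r ≤ 1) (hU : u < U)
    (hlim : ∀ (R : ℕ → ℝ) (ν : ProbabilityMeasure (NonemptyCompacts ℂ)),
      Tendsto R atTop atTop → Tendsto (lswLaw ∘ R) atTop (𝓝 ν) →
        (ν : Measure (NonemptyCompacts ℂ)).real (meetsClosedBall r) ≤ u) :
    ∃ s₀ : ℝ, ∀ R : ℝ, s₀ ≤ R →
      (triSitePercolation half).real (triOpenCrossing (r * R) R) ≤ U := by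
  by_contra hcon
  push Not at hcon
  choose R hRge hRlt using fun k : ℕ => hcon ((k : ℝ) + 1)
  have hRpos : ∀ k, 0 < R k := fun k => lt_of_lt_of_le (Nat.cast_add_one_pos k) (hRge k)
  have hRtop : Tendsto R atTop atTop := by
    refine tendsto_atTop_mono (fun k => (hRge k)) ?_
    exact tendsto_natCast_atTop_atTop.atTop_add tendsto_const_nhds
  obtain ⟨ν, φ, hφ, hconv⟩ := exists_tendsto_lswLaw_subseq R
  have hu := hlim (R ∘ φ) ν (hRtop.comp hφ.tendsto_atTop) hconv
  have hport : limsup (fun k => ((lswLaw ∘ R ∘ φ) k : Measure (NonemptyCompacts ℂ))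
      (meetsClosedBall r)) atTop ≤ (ν : Measure (NonemptyCompacts ℂ)) (meetsClosedBall r) :=
    ProbabilityMeasure.limsup_measure_closed_le_of_tendsto hconv (isClosed_meetsClosedBall r)
  have hge : ENNReal.ofReal U ≤ limsup (fun k => ((lswLaw ∘ R ∘ φ) k :
      Measure (NonemptyCompacts ℂ)) (meetsClosedBall r)) atTop := by
    refine le_limsup_of_frequently_le (Eventually.of_forall fun k => ?_).frequently
    simp only [Function.comp_apply]
    calc ENNReal.ofReal U
        ≤ ENNReal.ofReal ((triSitePercolation half).real
            (triOpenCrossing (r * R (φ k)) (R (φ k)))) := ENNReal.ofReal_le_ofReal (hRlt (φ k)).le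
      _ = (lswLaw (R (φ k)) : Measure (NonemptyCompacts ℂ)) (meetsBall r) :=
          (lswLaw_meetsBall_eq hr1 (hRpos (φ k))).symm
      _ ≤ (lswLaw (R (φ k)) : Measure (NonemptyCompacts ℂ)) (meetsClosedBall r) :=
          measure_mono (meetsBall_subset_meetsClosedBall r)
  have hU0 : 0 ≤ U := by
    linarith [measureReal_nonneg (μ := (ν : Measure (NonemptyCompacts ℂ)))
      (s := meetsClosedBall r)]
  have : U ≤ (ν : Measure (NonemptyCompacts ℂ)).real (meetsClosedBall r) := by
    rw [measureReal_def, ← ENNReal.toReal_ofReal hU0]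
    exact ENNReal.toReal_mono (measure_ne_top _ _) (hge.trans hport)
  linarith

/-- **LSW (3.1)-type bounds from uniform power bounds at subsequential limits.** If one
constant `C > 0` serves Thm. 1.2 for every subsequential weak limit of `lswLaw`
(`C⁻¹ r^a ≤ ν{dist(0, K) < r}`, `ν{dist(0, K) ≤ r} ≤ C r^a` for `r ∈ (0, 1/2)`), then for every
`r ∈ (0, 1/2)` and all large `R`, `C⁻¹ r^a / 2 ≤ P[C(rR, R)] ≤ 2 C r^a`.
[cite: LawlerSchrammWernerEJP2002, §3 (3.1) (p. 8)] -/
theorem crossingBounds_of_subseqLimits {C a : ℝ} (hC : 0 < C)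
    (hlim : ∀ (R : ℕ → ℝ) (ν : ProbabilityMeasure (NonemptyCompacts ℂ)),
      Tendsto R atTop atTop → Tendsto (lswLaw ∘ R) atTop (𝓝 ν) →
        ∀ r : ℝ, 0 < r → r < 1 / 2 →
          C⁻¹ * r ^ a ≤ (ν : Measure (NonemptyCompacts ℂ)).real (meetsBall r) ∧
            (ν : Measure (NonemptyCompacts ℂ)).real (meetsClosedBall r) ≤ C * r ^ a)
    {r : ℝ} (hr0 : 0 < r) (hr2 : r < 1 / 2) :
    ∃ s₀ : ℝ, ∀ R : ℝ, s₀ ≤ R →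
      C⁻¹ * r ^ a / 2 ≤ (triSitePercolation half).real (triOpenCrossing (r * R) R) ∧
        (triSitePercolation half).real (triOpenCrossing (r * R) R) ≤ 2 * (C * r ^ a) := by
  have hra : 0 < r ^ a := Real.rpow_pos_of_pos hr0 a
  have hℓ : 0 < C⁻¹ * r ^ a := mul_pos (inv_pos.2 hC) hra
  have hu : 0 < C * r ^ a := mul_pos hC hra
  obtain ⟨s₁, hs₁⟩ := eventually_le_crossing_of_subseqLimits (r := r) (ℓ := C⁻¹ * r ^ a)
    (L := C⁻¹ * r ^ a / 2) (by linarith) (by linarith)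
    (fun R ν hR hν => (hlim R ν hR hν r hr0 hr2).1)
  obtain ⟨s₂, hs₂⟩ := eventually_crossing_le_of_subseqLimits (r := r) (u := C * r ^ a)
    (U := 2 * (C * r ^ a)) (by linarith) (by linarith)
    (fun R ν hR hν => (hlim R ν hR hν r hr0 hr2).2)
  exact ⟨max s₁ s₂, fun R hR => ⟨hs₁ R ((le_max_left _ _).trans hR),
    hs₂ R ((le_max_right _ _).trans hR)⟩⟩

/-! ### Assembly -/

/-- A constant multiple of `r^a` has logarithmic exponent `a` at `0⁺`. [folklore] -/
theorem tendsto_log_const_mul_rpow_div_log {c a : ℝ} (hc : 0 < c) :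
    Tendsto (fun r => Real.log (c * r ^ a) / Real.log r) (𝓝[>] 0) (𝓝 a) :=
  tendsto_log_div_log_of_rpow_bounds (u := fun r => c * r ^ a) (L := c) (U := c) (δ := 1) hc hc
    one_pos fun _ _ _ => ⟨le_rfl, le_rfl⟩

/-- **The one-arm exponent from LSW §2 at subsequential limits** (LSW 2002, Thm. 1.1): the
subsequential hitting-PDE hypotheses — a datum `(h, h_θ, h_θθ, h_t)` with the properties of
Lemma 2.2, (2.3), Lemma 2.3 (`H`) identified through (2.2) at `θ = 2π` with every weak limit of
`lswLaw` along a sequence `R_k → ∞` (`hid`) — imply `oneArm_exponent`. The uniform constant of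
Thm. 1.2 over all subsequential limits comes from `IsHittingPDEData.measure_bounds` (maximum
principle (2.17), Koebe covering `koebeCovering_const`, (2.1)); `crossingBounds_of_subseqLimits`
turns it into one-sided (3.1)-type inputs `C⁻¹ r^{5/48}/2 ≤ P[C(rR, R)] ≤ 2 C r^{5/48}`, and
LSW §3 (`oneArm_exponent_of_crossingBounds`, with RSW circuits
`BollobasRiordan2006_openCircuit_holds`) concludes. Existence of the full scaling limit is not
used; with it, the hypotheses are supplied by
`LawlerSchrammWerner2002_subseqHittingPDE_of_scalingLimit`.
[cite: LawlerSchrammWernerEJP2002, Thm. 1.1, Thm. 1.2, §2–§3] -/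
theorem oneArm_exponent_of_subseqHittingPDE {h hθ hθθ ht : ℝ → ℝ → ℝ}
    (H : IsHittingPDEData h hθ hθθ ht)
    (hid : ∀ (R : ℕ → ℝ) (ν : ProbabilityMeasure (NonemptyCompacts ℂ)),
      Tendsto R atTop atTop → Tendsto (lswLaw ∘ R) atTop (𝓝 ν) →
        ∀ t, h (2 * Real.pi) t = (ν : Measure (NonemptyCompacts ℂ)).real
          {K | Literature.Analysis.Complex.conformalRadius (K : Set ℂ) ≤ Real.exp (-t)}) :
    oneArm_exponent := by
  obtain ⟨C, hC, hb⟩ := H.measure_bounds koebeCovering_const (by positivity)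
  have hlim : ∀ (R : ℕ → ℝ) (ν : ProbabilityMeasure (NonemptyCompacts ℂ)),
      Tendsto R atTop atTop → Tendsto (lswLaw ∘ R) atTop (𝓝 ν) →
        ∀ r : ℝ, 0 < r → r < 1 / 2 →
          C⁻¹ * r ^ (5 / 48 : ℝ) ≤ (ν : Measure (NonemptyCompacts ℂ)).real (meetsBall r) ∧
            (ν : Measure (NonemptyCompacts ℂ)).real (meetsClosedBall r) ≤ C * r ^ (5 / 48 : ℝ) :=
    fun R ν hR hν => hb ν (hid R ν hR hν)
  have hCinv2 : 0 < C⁻¹ / 2 := by positivity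
  refine oneArm_exponent_of_crossingBounds ⟨fun r => C⁻¹ / 2 * r ^ (5 / 48 : ℝ),
    tendsto_log_const_mul_rpow_div_log hCinv2, fun r hr0 hr2 => ⟨by positivity, ?_⟩⟩
    ⟨fun r => 2 * C * r ^ (5 / 48 : ℝ), tendsto_log_const_mul_rpow_div_log (by positivity),
    fun r hr0 hr2 => ?_⟩ BollobasRiordan2006_openCircuit_holds
  · obtain ⟨s₀, hs₀⟩ := crossingBounds_of_subseqLimits hC hlim hr0 hr2
    refine ⟨s₀, fun R hR => ?_⟩
    have h1 := (hs₀ R hR).1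
    have e : C⁻¹ / 2 * r ^ (5 / 48 : ℝ) = C⁻¹ * r ^ (5 / 48 : ℝ) / 2 := by ring
    show C⁻¹ / 2 * r ^ (5 / 48 : ℝ) ≤ _
    rwa [e]
  · obtain ⟨s₀, hs₀⟩ := crossingBounds_of_subseqLimits hC hlim hr0 hr2
    refine ⟨s₀, fun R hR => ?_⟩
    have h2 := (hs₀ R hR).2
    show _ ≤ 2 * C * r ^ (5 / 48 : ℝ)
    rwa [mul_assoc]

end Literature.Probability.Percolation
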